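import Mathlib.FieldTheory.Galois.Infinite
import Literature.AnabelianGeometry.AbsoluteAnabelian.RelativeGrothendieckConjecture
import Literature.AnabelianGeometry.AbsoluteAnabelian.SubpadicFiniteExtension
import Literature.AnabelianGeometry.AbsoluteAnabelian.SubpadicIsGeneralizedSubpadic
import HarnessLib

/-!
# "Center-free" ⇒ "slim" for absolute Galois groups ([pGC] Lem 15.8 / [Tpcs] Lem 4.14 as quoted in
# [AbsTopI] Example 4.8)

Proof-only companion to `RelativeGrothendieckConjecture.lean`: [AbsTopI] Example 4.8 (i)/(ii) p. 58
quotes [pGC] Lemma 15.8 p. 80 / [Tpcs] Lemma 4.14 p. 48 ("`Γ_K` is center-free") in the form "the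
absolute Galois group of a (generalized) sub-`p`-adic field is always *slim*".  The passage is the
standard one: an open subgroup of `G_K = Gal(K̄/K)` is `Gal(K̄/F)` for a finite extension `F/K`
(infinite Galois correspondence), `F` is again (generalized) sub-`p`-adic
(`SubpadicFiniteExtension.lean`), and an element centralizing an open subgroup `H` is central in the
open subgroup generated by `H` and itself.  Here this is PROVED: `pGC.Lem_15_8 → pGC.Lem_15_8_slim` and
`Tpcs.Lem_4_14 → Tpcs.Lem_4_14_slim` (named facts of `RelativeGrothendieckConjecture.lean`; for the
latter using `IsGeneralizedSubpadicFor.charZero`, proved here), via the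
general principle `isSlimGroup_absoluteGaloisGroup_of_center_eq_bot`.  Also the DISCHARGE
`Tpcs.rmk_4_11_holds` of the named fact `Tpcs.Rmk_4_11` (sub-`p`-adic ⇒ generalized sub-`p`-adic,
[Tpcs] Rmk after Def 4.11 p. 44) from `SubpadicIsGeneralizedSubpadic.lean`.  No new definitions.
[cite: MochizukiAbsTopI2012, Ex 4.8 (ii) p.58]
-/

universe u

namespace Literature.AnabelianGeometry.AbsoluteAnabelian

open AbsTopIII Literature.AlgebraicGeometry.Frobenioids

/-- If the absolute Galois group of every finite subextension `K ⊆ F ⊆ K̄` is center-free, then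
`G_K = Gal(K̄/K)` is slim (every open subgroup has trivial centralizer) — the group-theoretic passage
from "[pGC] Lemma 15.8: `Γ_K` is center-free" to "[AbsTopI] Ex 4.8 (ii): the absolute Galois group of
a sub-`p`-adic field is always slim" (`K` of characteristic zero, so that `K̄/K` is Galois).
[cite: MochizukiAbsTopI2012, Ex 4.8 (ii) p.58] -/
theorem isSlimGroup_absoluteGaloisGroup_of_center_eq_bot {K : Type u} [Field K] [CharZero K]
    (h : ∀ F : IntermediateField K (AlgebraicClosure K), FiniteDimensional K F →
      Subgroup.center (Field.absoluteGaloisGroup F) = ⊥) :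
    IsSlimGroup (Field.absoluteGaloisGroup K) := by
  classical
  refine ⟨fun H hH => ?_⟩
  rw [eq_bot_iff]
  intro z hz
  -- the open subgroup generated by `H` and `z`, in which `z` is central
  let H₂ : Subgroup (Field.absoluteGaloisGroup K) := H ⊔ Subgroup.zpowers z
  have hle : H ≤ H₂ := le_sup_left
  have hzH₂ : z ∈ H₂ := (le_sup_right : Subgroup.zpowers z ≤ H₂) (Subgroup.mem_zpowers z)
  have hH₂open : IsOpen (H₂ : Set (Field.absoluteGaloisGroup K)) := Subgroup.isOpen_mono hle hH
  have hcomm : H₂ ≤ Subgroup.centralizer {z} := by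
    refine sup_le (fun g hg => ?_) ((Subgroup.zpowers_le).mpr ?_)
    · -- `g ∈ H` commutes with `z ∈ Z_G(H)`
      rw [Subgroup.mem_centralizer_iff]
      rintro _ rfl
      exact ((Subgroup.mem_centralizer_iff.mp hz) g hg).symm
    · rw [Subgroup.mem_centralizer_iff]
      rintro _ rfl
      rfl
  -- `H₂` is closed, hence `H₂ = Gal(K̄/F)` for `F := K̄^{H₂}`, and `F/K` is finite
  have hH₂closed : IsClosed (H₂ : Set (Field.absoluteGaloisGroup K)) :=
    Subgroup.isClosed_of_isOpen H₂ hH₂open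
  let H₂c : ClosedSubgroup (AlgebraicClosure K ≃ₐ[K] AlgebraicClosure K) := ⟨H₂, hH₂closed⟩
  let F : IntermediateField K (AlgebraicClosure K) := IntermediateField.fixedField H₂
  have hfix : F.fixingSubgroup = H₂ := InfiniteGalois.fixingSubgroup_fixedField H₂c
  have hfin : FiniteDimensional K F := by
    refine (InfiniteGalois.isOpen_iff_finite F).mp ?_
    change IsOpen (F.fixingSubgroup : Set (AlgebraicClosure K ≃ₐ[K] AlgebraicClosure K))
    rw [hfix]
    exact hH₂open
  -- `H₂ ≃* Gal(K̄/F) ≃* Gal(F̄/F) = G_F`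
  let e₁ : H₂ ≃* F.fixingSubgroup := MulEquiv.subgroupCongr hfix.symm
  let e₂ : F.fixingSubgroup ≃* (AlgebraicClosure K ≃ₐ[F] AlgebraicClosure K) :=
    IntermediateField.fixingSubgroupEquiv F
  haveI : Algebra.IsAlgebraic F (AlgebraicClosure K) :=
    Algebra.IsAlgebraic.tower_top (K := K) (L := F)
  haveI : IsAlgClosure F (AlgebraicClosure K) :=
    { isAlgClosed := inferInstance, isAlgebraic := inferInstance }
  let e₃ : (AlgebraicClosure K ≃ₐ[F] AlgebraicClosure K) ≃* Field.absoluteGaloisGroup F :=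
    (IsAlgClosure.equiv F (AlgebraicClosure K) (AlgebraicClosure F)).autCongr
  let Θ : H₂ ≃* Field.absoluteGaloisGroup F := e₁.trans (e₂.trans e₃)
  -- `z` is central in `H₂`, hence `Θ z` is central in `G_F`, hence trivial
  have hzc : (⟨z, hzH₂⟩ : H₂) ∈ Subgroup.center H₂ := by
    rw [Subgroup.mem_center_iff]
    intro g
    apply Subtype.ext
    have := (Subgroup.mem_centralizer_iff.mp (hcomm g.2)) z rfl
    -- `this : z * g = g * z`
    change (g : Field.absoluteGaloisGroup K) * z = z * g
    exact this.symm
  have hΘz : Θ ⟨z, hzH₂⟩ ∈ Subgroup.center (Field.absoluteGaloisGroup F) := by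
    rw [Subgroup.mem_center_iff]
    intro g'
    obtain ⟨g, rfl⟩ := Θ.surjective g'
    rw [← map_mul, ← map_mul, Subgroup.mem_center_iff.mp hzc g]
  rw [h F hfin, Subgroup.mem_bot, MulEquiv.map_eq_one_iff] at hΘz
  exact Subgroup.mem_bot.mpr (congrArg Subtype.val hΘz)

/-- [pGC] Lemma 15.8 ("`Γ_K` center-free for sub-`p`-adic `K`") implies its slim form quoted in
[AbsTopI] Example 4.8 (ii): PROVED reduction between the two named facts of
`RelativeGrothendieckConjecture.lean`. [cite: MochizukiAbsTopI2012, Ex 4.8 (ii) p.58] -/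
theorem pGC.lem_15_8_slim_of_lem_15_8 (h : pGC.Lem_15_8.{u}) : pGC.Lem_15_8_slim.{u} := by
  intro K _ hK
  obtain ⟨p, hp, hKp⟩ := hK.exists_prime
  haveI : CharZero K := hKp.charZero
  exact isSlimGroup_absoluteGaloisGroup_of_center_eq_bot fun F _ => h F (hK.of_finite (F := F))

/-- A generalized sub-`p`-adic field has characteristic zero: it maps into an extension of
`Frac W(𝔽̄_p) ⊇ ℚ_p` (`AbsTopIII.nonempty_padic_ringHom_fracWitt`). [cite: MochizukiTopics2003, Def 4.11 p.44] -/
theorem AbsTopIII.IsGeneralizedSubpadicFor.charZero {K : Type u} [Field K] {p : ℕ} [Fact p.Prime]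
    (hK : IsGeneralizedSubpadicFor K p) : CharZero K := by
  obtain ⟨L, _, _, _, ⟨ι⟩⟩ := hK.exists_embedding
  obtain ⟨φ₀⟩ := AbsTopIII.nonempty_padic_ringHom_fracWitt p
  haveI : CharZero (FractionRing (WittVector p (AlgebraicClosure (ZMod p)))) :=
    charZero_of_injective_ringHom φ₀.injective
  haveI : CharZero L :=
    charZero_of_injective_ringHom
      (algebraMap (FractionRing (WittVector p (AlgebraicClosure (ZMod p)))) L).injective
  exact ι.charZero

/-- [Tpcs] Lemma 4.14 ("`Γ_K` center-free for generalized sub-`p`-adic `K`") implies its slim form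
quoted in [AbsTopI] Example 4.8 (i): PROVED reduction between the two named facts of
`RelativeGrothendieckConjecture.lean`. [cite: MochizukiAbsTopI2012, Ex 4.8 (i) p.58] -/
theorem Tpcs.lem_4_14_slim_of_lem_4_14 (h : Tpcs.Lem_4_14.{u}) : Tpcs.Lem_4_14_slim.{u} := by
  intro K _ p _ hK
  haveI : CharZero K := hK.charZero
  exact isSlimGroup_absoluteGaloisGroup_of_center_eq_bot fun F _ => h F p (hK.of_finite (F := F))

/-- DISCHARGE of the named fact `Tpcs.Rmk_4_11` ([Tpcs] Remark following Def 4.11 p. 44: "sub-`p`-adic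
fields are always generalized sub-`p`-adic"), by `AbsTopIII.IsSubpadicFor.isGeneralizedSubpadicFor`.
[cite: MochizukiTopics2003, Def 4.11 p.44] -/
theorem Tpcs.rmk_4_11_holds : Tpcs.Rmk_4_11.{u} :=
  fun _ _ _ _ hK => hK.isGeneralizedSubpadicFor

end Literature.AnabelianGeometry.AbsoluteAnabelian
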